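import Summits.Ventures.YMGap.Conjectures.StrongCouplingChiralLROMesonWeightTranslation
import Summits.Ventures.YMGap.Conjectures.StrongCouplingChiralLROMesonWeightAxisPermutationGauge
import Summits.Ventures.YMGap.Conjectures.StrongCouplingChiralLROMesonWeightAllPlanes
import HarnessLib
import HarnessLib.Audit.Tags

/-!
# Lattice symmetries of the meson moments (2b/2): axis permutations — the meson moments
# `S_β(∏σ̂^m)` are invariant under every permutation of the coordinate axes

Cell `pub-ymgap`, seat qcd-lit g21 (literature-prover), `bears_on: Q1`.  Everything is a theorem
(0 facts, 0 sorry).  This file discharges hypothesis `hP` of `…MesonWeightAllPlanes` /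
`…MesonWeightInfraredBound`.

The staggered phases `η_μ(x) = (-1)^{x_0+⋯+x_{μ-1}}` are not invariant under a transposition of two
adjacent axes `j, k = j+1`, but they are up to the SITE sign gauge `s(x) = (-1)^{x_j x_k}`:
`s(x) s(x+e_μ) η_μ(x) = η_{σμ}(x∘σ)` (`swapSign_phase`, `σ = (j k)`; `L` even).  Hence the site
relabelling `ψ_a(x) ↦ s(x)ψ_a(x∘σ)` of `…MesonWeightTranslation` carries the massless periodic action to
the action in the permuted gauge field (`swapF_actionOn`), and with the invariance of `∏dU e^{-βS_W}`
under axis permutations (`…AxisPermutationGauge`) the meson moments are invariant under adjacent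
transpositions (`mesonMoment_mapDomain_adjSwap`), hence under every permutation of the axes
(`mesonMoment_mapDomain_coordPerm`, adjacent transpositions generate) and in particular under the
transpositions `axisSwap i` (`mesonMoment_mapDomain_axisSwap`).

Honest framing: finite even torus `(ℤ/Lℤ)^ν`, periodic b.c., every real `β`, every `N`; nothing about
the continuum or the summit's `QCD` conjunct.

## References
* [MontvayMunster1994] I. Montvay, G. Münster, *Quantum Fields on a Lattice*, CUP 1994, §4.3
  (4.186)–(4.190) (lattice symmetries of staggered fermions).
* [SalmhoferSeiler1991] M. Salmhofer, E. Seiler, Commun. Math. Phys. 139 (1991) 395–432, §2 (2.3)–(2.4).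
-/

noncomputable section

open MeasureTheory Finset MvPolynomial
open scoped ComplexConjugate BigOperators
open Literature.MathematicalPhysics.QuantumFieldTheory (Site Edge GaugeConfig)
open Literature.MathematicalPhysics.QuantumLattice
open Literature.MathematicalPhysics.QuantumLattice.GrassmannAlgebra
open Literature.MathematicalPhysics.QuantumLattice.StrongCoupling
open Literature.MathematicalPhysics.QuantumLattice.StaggeredShift (int_pow_val_add coe_staggeredPhase)
open Literature.MathematicalPhysics.StatisticalMechanics
open Literature.MathematicalPhysics.StatisticalMechanics.ComplexSpin
open Literature.Probability.LatticeModels (TorusSite)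

namespace Summit.Ventures.YMGap.Conjectures

namespace MesonWeight

open SchwingerDyson

variable {N ν L : ℕ} [NeZero L]

/-! ### Sums over the directions below `μ` -/

/-- `{l < k} = {l < j} ∪ {j}` for `k = j + 1`. [cite: MontvayMunster1994, §4.3] -/
theorem sum_filter_lt_succ {j k : Fin ν} (hjk : (k : ℕ) = j + 1) (f : Fin ν → ℕ) :
    ∑ l ∈ Finset.univ.filter (· < k), f l = (∑ l ∈ Finset.univ.filter (· < j), f l) + f j := by
  have h : Finset.univ.filter (· < k) = insert j (Finset.univ.filter (fun l : Fin ν => l < j)) := by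
    ext l
    simp only [Finset.mem_filter, Finset.mem_univ, true_and, Finset.mem_insert, Fin.lt_def, Fin.ext_iff]
    omega
  rw [h, Finset.sum_insert (by simp), add_comm]

/-- Relabelling `{l < μ}` by the transposition `(j k)` when `μ ≤ j` or `k < μ`. [cite: MontvayMunster1994, §4.3] -/
theorem sum_filter_lt_comp_swap {j k μ : Fin ν} (hjk : (k : ℕ) = j + 1) (hμ : (μ : ℕ) ≤ j ∨ (k : ℕ) < μ)
    (f : Fin ν → ℕ) :
    ∑ l ∈ Finset.univ.filter (· < μ), f (Equiv.swap j k l) = ∑ l ∈ Finset.univ.filter (· < μ), f l := by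
  refine Finset.sum_equiv (Equiv.swap j k) (fun l => ?_) (fun l _ => rfl)
  simp only [Finset.mem_filter, Finset.mem_univ, true_and, Fin.lt_def]
  rcases eq_or_ne l j with rfl | hlj
  · rw [Equiv.swap_apply_left]; omega
  rcases eq_or_ne l k with rfl | hlk
  · rw [Equiv.swap_apply_right]; omega
  rw [Equiv.swap_apply_of_ne_of_ne hlj hlk]

/-! ### The sign gauge of an adjacent transposition and the phase identity -/

/-- **The site sign** `s(x) = (-1)^{x_j x_k}` compensating the change of the staggered phases under the
transposition of the axes `j, k = j + 1`. [cite: MontvayMunster1994, §4.3 (4.186)–(4.190)] -/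
def swapSign (j k : Fin ν) (x : TorusSite ν L) : ℂ := (((-1 : ℤ) ^ ((x j).val * (x k).val) : ℤ) : ℂ)

omit [NeZero L] in
/-- `s(x)² = 1`. [cite: MontvayMunster1994, §4.3] -/
theorem swapSign_mul_self (j k : Fin ν) (x : TorusSite ν L) : swapSign j k x * swapSign j k x = 1 := by
  rw [swapSign, ← Int.cast_mul, ← mul_pow]
  norm_num

/-- `(-1)^n (-1)^n = 1`. [folklore] -/
theorem neg_one_pow_mul_self' (n : ℕ) : ((-1 : ℤ) ^ n) * (-1) ^ n = 1 := by
  rw [← mul_pow]; norm_num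

/-- `(-1)^{(a+1)n} = (-1)^n (-1)^{an}` on `ℤ/Lℤ`, `L` even. [cite: MontvayMunster1994, §4.3] -/
theorem neg_one_pow_val_add_one_mul (hL : Even L) (a : ZMod L) (n : ℕ) :
    (-1 : ℤ) ^ ((a + 1).val * n) = (-1) ^ n * (-1) ^ (a.val * n) := by
  have hL2 : 2 ≤ L := by obtain ⟨t, ht⟩ := hL; have := NeZero.ne L; omega
  haveI : Fact (1 < L) := ⟨by omega⟩
  rw [pow_mul, pow_mul, int_pow_val_add hL (by norm_num) a 1, ZMod.val_one, pow_one]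
  ring

/-- **The phase identity** `s(x) s(x + e_μ) η_μ(x) = η_{σμ}(x∘σ)` for the transposition `σ = (j k)` of two
adjacent axes (`L` even). [cite: MontvayMunster1994, §4.3 (4.186)–(4.190)] -/
theorem swapSign_phase (hL : Even L) {j k : Fin ν} (hjk : (k : ℕ) = j + 1) (x : TorusSite ν L) (μ : Fin ν) :
    swapSign j k x * swapSign j k (x + Pi.single μ 1) * stagSigns ν L (x, μ) =
      stagSigns ν L (coordPerm (Equiv.swap j k) x, Equiv.swap j k μ) := by
  have hjk' : j ≠ k := fun h => by rw [h] at hjk; omega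
  simp only [swapSign, stagSigns, coe_staggeredPhase, coordPerm_apply, ← Int.cast_mul]
  congr 1
  have hlj : ∀ l : Fin ν, l < j → Equiv.swap j k l = l := fun l hl =>
    Equiv.swap_apply_of_ne_of_ne (ne_of_lt hl) (fun h => by rw [h, Fin.lt_def] at hl; omega)
  have hTj : ∑ l ∈ Finset.univ.filter (· < j), (x (Equiv.swap j k l)).val = ∑ l ∈ Finset.univ.filter (· < j), (x l).val :=
    sum_filter_lt_comp_swap hjk (Or.inl le_rfl) (fun l => (x l).val)
  by_cases hμj : μ = j
  · subst hμj
    rw [Equiv.swap_apply_left, Pi.add_apply, Pi.add_apply, Pi.single_eq_same, Pi.single_eq_of_ne hjk'.symm, add_zero,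
      neg_one_pow_val_add_one_mul hL, sum_filter_lt_succ hjk, hTj, Equiv.swap_apply_left, pow_add]
    linear_combination ((-1 : ℤ) ^ (x k).val * (-1) ^ (∑ l ∈ Finset.univ.filter (· < μ), (x l).val)) *
      neg_one_pow_mul_self' ((x μ).val * (x k).val)
  by_cases hμk : μ = k
  · subst hμk
    rw [Equiv.swap_apply_right, Pi.add_apply, Pi.add_apply, Pi.single_eq_same, Pi.single_eq_of_ne hjk', add_zero,
      mul_comm (x j).val (x μ + 1).val, neg_one_pow_val_add_one_mul hL, mul_comm (x μ).val (x j).val,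
      sum_filter_lt_succ hjk, hTj, pow_add]
    linear_combination ((-1 : ℤ) ^ (∑ l ∈ Finset.univ.filter (· < j), (x l).val) * (-1) ^ ((x j).val * (x μ).val) *
        (-1) ^ ((x j).val * (x μ).val)) * neg_one_pow_mul_self' (x j).val +
      ((-1 : ℤ) ^ (∑ l ∈ Finset.univ.filter (· < j), (x l).val)) * neg_one_pow_mul_self' ((x j).val * (x μ).val)
  · have hμ' : (μ : ℕ) ≤ j ∨ (k : ℕ) < μ := by
      have h1 : (μ : ℕ) ≠ j := fun h => hμj (Fin.ext h)
      have h2 : (μ : ℕ) ≠ k := fun h => hμk (Fin.ext h)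
      omega
    have h3 : ∑ l ∈ Finset.univ.filter (· < μ), (x (Equiv.swap j k l)).val = ∑ l ∈ Finset.univ.filter (· < μ), (x l).val :=
      sum_filter_lt_comp_swap hjk hμ' (fun l => (x l).val)
    rw [Equiv.swap_apply_of_ne_of_ne hμj hμk, Pi.add_apply, Pi.add_apply, Pi.single_eq_of_ne (Ne.symm hμj),
      Pi.single_eq_of_ne (Ne.symm hμk), add_zero, add_zero, h3]
    linear_combination ((-1 : ℤ) ^ (∑ l ∈ Finset.univ.filter (· < μ), (x l).val)) *
      neg_one_pow_mul_self' ((x j).val * (x k).val)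

/-! ### The relabelling by an adjacent transposition carries the action to the permuted gauge field -/

section Fermi

variable [LinearOrder (TorusSite ν L)]

variable (N) in
/-- **The axis transposition with its sign gauge**: `ψ_a(x) ↦ s(x) ψ_a(x ∘ σ)`, `σ = (j k)`. [cite: MontvayMunster1994, §4.3] -/
abbrev swapF (j k : Fin ν) : FermiAlg (TorusSite ν L) N →ₐ[ℂ] FermiAlg (TorusSite ν L) N :=
  siteRelabel N (coordPerm (Equiv.swap j k)) (swapSign j k)

/-- `ρ(A_b(U_b)) = A_{σb}((σU)_{σb})` bond by bond. [cite: MontvayMunster1994, §4.3 (4.186)–(4.190)] -/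
theorem swapF_bondTerm (hL : Even L) {j k : Fin ν} (hjk : (k : ℕ) = j + 1) (U : GaugeConfig ν L (UN N))
    (b : TorusSite ν L × Fin ν) :
    swapF N j k (StrongCoupling.bondTerm (torusLinks ν L) (stagSigns ν L) U b) =
      StrongCoupling.bondTerm (torusLinks ν L) (stagSigns ν L) (configPerm N (Equiv.swap j k) U)
        (edgePerm (Equiv.swap j k) b) := by
  obtain ⟨x, μ⟩ := b
  have hph := swapSign_phase hL hjk x μ
  simp only [StrongCoupling.bondTerm, configPerm_apply_edgePerm]
  simp only [torusLinks, edgePerm_apply, Equiv.symm_swap, map_add, map_smul, siteRelabel_hopAt,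
    coordPerm_add_single, smul_smul, ← hph]
  congr 1
  · congr 1; ring
  · congr 1; ring

/-- `ρ(A(U)) = A(σU)`. [cite: MontvayMunster1994, §4.3 (4.186)–(4.190)] -/
theorem swapF_actionOn (hL : Even L) {j k : Fin ν} (hjk : (k : ℕ) = j + 1) (U : GaugeConfig ν L (UN N)) :
    swapF N j k (actionOn Finset.univ (torusLinks ν L) (stagSigns ν L) U) =
      actionOn Finset.univ (torusLinks ν L) (stagSigns ν L) (configPerm N (Equiv.swap j k) U) := by
  rw [actionOn, actionOn, map_sum]
  simp_rw [swapF_bondTerm hL hjk]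
  exact Fintype.sum_equiv (edgePerm (Equiv.swap j k)) _ _ fun b => rfl

/-- `ρ(e^{A(U)}) = e^{A(σU)}`. [cite: MontvayMunster1994, §4.3] -/
theorem swapF_fermiW (hL : Even L) {j k : Fin ν} (hjk : (k : ℕ) = j + 1) (U : GaugeConfig ν L (UN N)) :
    swapF N j k (fermiW U) = fermiW (configPerm N (Equiv.swap j k) U) := by
  rw [show fermiW U = grassmannExp (actionOn Finset.univ (torusLinks ν L) (stagSigns ν L) U) from rfl,
    map_grassmannExp_eq, swapF_actionOn hL hjk]

/-- **`J_β(ρ G) = det ρ · J_β(G)`** for the adjacent transposition. [cite: SalmhoferSeiler1991, §2 (2.9)–(2.12)] -/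
theorem sdJ_swapF (hL : Even L) {j k : Fin ν} (hjk : (k : ℕ) = j + 1) (β : ℝ) (G : FermiAlg (TorusSite ν L) N) :
    sdJ N ν L β (swapF N j k G) =
      LinearMap.det (siteSubst (N := N) (coordPerm (L := L) (Equiv.swap j k)) (swapSign j k)) * sdJ N ν L β G := by
  rw [sdJ, sdJ, ← integral_const_mul,
    ← (measurePreserving_configPerm (N := N) (L := L) (Equiv.swap j k)).integral_comp
      (configPerm N (Equiv.swap j k)).measurableEmbedding]
  refine integral_congr_ae (ae_of_all _ fun V => ?_)
  dsimp only
  rw [plaq_configPerm, ← swapF_fermiW hL hjk, ← map_mul, berezin_siteRelabel]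
  ring

/-- `det ρ = 1`. [cite: Berezin1966, Ch. I §3] -/
theorem det_swap_eq_one [NeZero ν] (hL : Even L) {j k : Fin ν} (hjk : (k : ℕ) = j + 1) :
    LinearMap.det (siteSubst (N := N) (coordPerm (L := L) (Equiv.swap j k)) (swapSign j k)) = 1 := by
  have h := sdJ_swapF (N := N) hL hjk 0 1
  rw [map_one] at h
  have h1 : sdJ N ν L 0 (1 : FermiAlg (TorusSite ν L) N) ≠ 0 := by
    rw [sdJ_one_eq hL]
    exact mul_ne_zero (fun h0 => by
      have := chiralSign_mul_self (N := N) (evens ν L); rw [h0, zero_mul] at this; exact zero_ne_one this)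
      (Complex.ofReal_ne_zero.2 (sdS_one_pos hL 0).ne')
  exact (mul_eq_right₀ h1).1 h.symm

/-- **The meson moments are invariant under adjacent transpositions of the axes.** [cite: MontvayMunster1994, §4.3] -/
theorem mesonMoment_mapDomain_adjSwap [NeZero ν] (hL : Even L) {j k : Fin ν} (hjk : (k : ℕ) = j + 1) (β : ℝ)
    (m : TorusSite ν L →₀ ℕ) :
    mesonMoment N ν L β (Finsupp.mapDomain (coordPerm (Equiv.swap j k)) m) = mesonMoment N ν L β m := by
  rw [mesonMoment, mesonMoment, ← rename_monomial,
    ← siteRelabel_bos (coordPerm (Equiv.swap j k)) (swapSign_mul_self j k), sdJ_swapF hL hjk, det_swap_eq_one hL hjk,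
    one_mul]

/-! ### All permutations of the axes -/

/-- **THE MESON MOMENTS ARE INVARIANT UNDER EVERY PERMUTATION OF THE AXES** (adjacent transpositions
generate the symmetric group). [cite: MontvayMunster1994, §4.3] -/
theorem mesonMoment_mapDomain_coordPerm [NeZero ν] (hL : Even L) (β : ℝ) (σ : Equiv.Perm (Fin ν))
    (m : TorusSite ν L →₀ ℕ) :
    mesonMoment N ν L β (Finsupp.mapDomain (coordPerm σ) m) = mesonMoment N ν L β m := by
  obtain ⟨n, hn⟩ := Nat.exists_eq_succ_of_ne_zero (NeZero.ne ν)
  subst hn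
  have hσ : σ ∈ Submonoid.closure (Set.range fun i : Fin n => Equiv.swap i.castSucc i.succ) := by
    rw [Equiv.Perm.mclosure_swap_castSucc_succ]; exact Submonoid.mem_top σ
  revert m
  refine Submonoid.closure_induction (fun τ hτ => ?_) (fun m => ?_) (fun τ τ' _ _ hτ hτ' m => ?_) hσ
  · obtain ⟨i, rfl⟩ := hτ
    exact fun m => mesonMoment_mapDomain_adjSwap hL (by simp [Fin.val_succ]) β m
  · rw [show (⇑(coordPerm (L := L) (1 : Equiv.Perm (Fin (n + 1)))) : TorusSite (n + 1) L → TorusSite (n + 1) L) = id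
      from funext fun x => funext fun l => rfl, Finsupp.mapDomain_id]
  · rw [show (⇑(coordPerm (L := L) (τ * τ')) : TorusSite (n + 1) L → TorusSite (n + 1) L) =
        ⇑(coordPerm (L := L) τ') ∘ ⇑(coordPerm (L := L) τ) from funext fun x => funext fun l => rfl,
      Finsupp.mapDomain_comp, hτ', hτ]

/-- **Hypothesis `hP` of `…MesonWeightInfraredBound`, discharged**: the meson moments are invariant under
the axis transpositions `axisSwap i`. [cite: MontvayMunster1994, §4.3] -/
theorem mesonMoment_mapDomain_axisSwap [NeZero ν] (hL : Even L) (β : ℝ) (i : Fin ν) (m : TorusSite ν L →₀ ℕ) :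
    mesonMoment N ν L β (Finsupp.mapDomain (axisSwap i) m) = mesonMoment N ν L β m := by
  rw [show (⇑(axisSwap (L := L) i) : TorusSite ν L → TorusSite ν L) = ⇑(coordPerm (L := L) (Equiv.swap 0 i))
    from funext fun x => rfl]
  exact mesonMoment_mapDomain_coordPerm hL β _ m

end Fermi

end MesonWeight

end Summit.Ventures.YMGap.Conjectures

end
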